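import Literature.MathematicalPhysics.QuantumFieldTheory.Balaban1983to89.Node00.MultiScaleFibreChart
import Literature.MathematicalPhysics.QuantumFieldTheory.Balaban1983to89.Node00.CriticalOnFibreTangentB

/-!
# NODE 00 — THE CANONICAL LOGARITHMIC CHART OF A MULTI-SCALE CONSTRAINT `Ū^j = W_j` **ON A BOND-LEVEL DATUM `𝐁ᵇ`**, AND THE TANGENT FORM (82) ON THE [II] (2.3) FIBRE MODULO [15] (45) —
# the print-datum edition of n07-w2's `Node00/MultiScaleFibreChart` §3–§6 (`ConstrSetB ∕ constrCardB ∕ constrEnumB ∕ msChartB` and every chart theorem over `𝔅 : BDetSet`), keyed on F0a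
# `AgreeOnB`, F0b `IsCritOnFibreB` and the lane's `IsFibreChartNearB`

statement-level skeleton of published theorems with citation tags; proofs where landed; nothing here is a claim about
the Yang–Mills mass gap

Cell `pub-ymgap` (HUMAN RULINGS D-0062 ∕ D-0149), lane `pub-ymgap-dag-n12-c` g35 (R134 seat (a), N12 = [B15], s1, lane owner); `--kind definition --supports` K1⁹ `stmt-QuantumFields-27364`;
count-neutral.  (E1) variant (iii-b), class (γ) of the lane's census-by-declaration (bus [DAGN12C-G35], 2026-08-30): n07-w2's chart module is the ROOT of the chart ∕ slice ∕ forest layer of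
N12's Proposition-1 road (dag-n12-d's LEVEL 0–2: `…N12FlatChartDerivIterLin`, `…N12FlatStraightOntoGenSet`, …; the lane's F3 head letters `msChart F 2 Kt (k i) (Bj …) …`); six of its
declarations with datum-bearing statements are used by the junction of record v14ᴸ (`contDiffAt_msChart`, `hasStrictFDerivAt_msChart`, `fderiv_msChart_apply_of_hasDerivAt`,
`msChart_zero_of_agreeOn`, `relAvg_eq_one_of_agreeOn`, `eventually_norm_relAvg_sub_one_le`).  The parent reads its determining set `𝐁 : DetSet` ONLY through `bondsOf (𝐁 j)` and `AgreeOn 𝐁`,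
so the bond-datum edition is a GENERATOR twin (HOME `lean/g35/gen/gen_MSFCB.py` over the parent's tree bytes, every substitution asserted): `(𝐁 : DetSet) ↦ (𝔅 : BDetSet)`, `bondsOf (𝐁 j) ↦ 𝔅 j`,
`AgreeOn ↦ AgreeOnB` (F0a), `IsCritOnFibre ↦ IsCritOnFibreB` (F0b), `IsFibreChartNear ↦ IsFibreChartNearB` (lane, `CriticalOnFibreTangentB`), names `…B`; the datum-FREE parts of the parent
(`suProj`, `rhoSU`, `relAvg`, `relAvg_mem_SU`, `avg_eq_of_relAvg_eq_one`, `contDiffAt_star_mul_iterM_expChart`, `relAvg_expChart_eq_of_smallBelow`, `eventually_smallBelow_expChart`, §1–§2) are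
REUSED BY NAME, not copied.  §7: reading (b)'s `ConstrSet ∕ constrCard ∕ msChart … 𝐁` ARE the bond-datum objects at `bondsDet 𝐁` by `rfl`.

HONESTY GUARD (director-ym №338 (5)).  PURELY ADDITIVE: `Node00/MultiScaleFibreChart` stays landed and true on its own text; nothing in it or in 35a ∕ F0a ∕ F0b is edited; no displayed premise
of any consumer is deleted or weakened.  Kernel calculus on the tree's own averaging and group; the right inverse (45) at `U` is a DISPLAYED HYPOTHESIS (`hH`); no estimate of [15] proved; stub 1
∕ K0⁷ ∕ K1⁹ NOT closed; N07 ∕ N12 NOT discharged; one finite 𝕋⁴ programme at fixed ε — NOT continuum ∕ ℝ⁴ ∕ OS ∕ mass gap ∕ Clay.  No `sorry`, no `axiom`, no `instance`, no `notation`.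

WHAT IS HERE.  §3ᴮ `ConstrSetB` · `constrCardB` · `constrEnumB` · ★ `msChartB` · `msChartB_apply` · `relAvg_eq_one_of_agreeOnB` · `msChartB_zero_of_agreeOnB`; §4ᴮ ★ `contDiffAt_msChartB` ·
★ `hasStrictFDerivAt_msChartB` · ★★ `fderiv_msChartB_apply_of_hasDerivAt`; §5ᴮ `eventually_norm_relAvg_sub_one_le_constrB` · ★ `eventually_agreeOnB_of_msChartB_eq`; §6ᴮ ★★ `isFibreChartNearB_msChartB` ·
★★★ `hasDerivAt_wilsonAction4_expChart_of_isCritOnFibreB_of_rightInverse` · `…_lamBondsSeq_of_rightInverse` (print's [II] (2.3) fibre); §7 `constrSet_eq_constrSetB_bondsDet` ·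
`constrCard_eq_constrCardB_bondsDet` · `msChart_eq_msChartB_bondsDet` (`rfl`).

References: [15] = [Balaban1985Variational] (3),(5)–(7) p.278, Sect. C (44)–(48) p.285, Prop. 3 p.289, (82)–(83) p.290, (141) p.299, Prop. 8 p.304; [III] = [Balaban1988Convergent] (2.2) p.255,
(2.10)–(2.12) p.256; [II] = [Balaban1984PropagatorsII] (2.3) p.224; [I] = [Balaban1987RG1] (0.4) p.253, (0.21) p.256; [Balaban1985Averaging] (17)–(21) p.21.
-/

noncomputable section

namespace Literature.MathematicalPhysics.QuantumFieldTheory.Balaban1983to89.Node00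

open Filter Topology
open T4Continuum (T4Family)
open B15DeterminingSets B15DeterminingSetsB
open BlockAveraging (blockAvg Small Idx loopHol)
open ExpMeanLog (expMeanLogSU deltaSU)
open MatrixLog (mlog mlog_one exp_mlog analyticAt_mlog)
open T4AdjointCovarianceUnitary (lieSU expSU coe_expSU mem_lieSU_iff)
open scoped Matrix.Norms.L2Operator

/-! ## §3ᴮ  The canonical chart of a multi-scale constraint `Ū^j = W_j` on the bonds of a level-bounded BOND datum -/

section Chart

variable (F : T4Family) (N : ℕ) [NeZero N]

/-- **The CONSTRAINED BONDS of levels `≤ k` of a determining set `𝐁`**: pairs `(j, c)` with `j ≤ k` and `c` a `j`-bond MEETING `Γ_j` (`B15DeterminingSets.bondsOf`, the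
reading of `AgreeOn`).  A finite type (finitely many bonds per level). [cite: Balaban1988Convergent, (2.2) p.255, (2.10) p.256] -/
abbrev ConstrSetB {P : Params} (𝔅 : BDetSet P) (k : ℕ) : Type := Σ j : Fin (k + 1), {c : PBond P j // c ∈ 𝔅 j}

/-- The number of constrained bonds of levels `≤ k`. [cite: Balaban1988Convergent, (2.2) p.255 (bookkeeping)] -/
def constrCardB {P : Params} (𝔅 : BDetSet P) (k : ℕ) : ℕ := Nat.card (ConstrSetB 𝔅 k)

/-- An enumeration of the constrained bonds of levels `≤ k` (the target of the chart is `𝔰𝔲(N)^{#constraints}`). [cite: Balaban1988Convergent, (2.2) p.255 (bookkeeping)] -/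
def constrEnumB {P : Params} (𝔅 : BDetSet P) (k : ℕ) : ConstrSetB 𝔅 k ≃ Fin (constrCardB 𝔅 k) := Finite.equivFin _

/-- ★ **THE CANONICAL LOGARITHMIC CHART OF THE MULTI-SCALE CONSTRAINT `Ū^j = W_j` ON `𝐁` AT `U`**: `Φ(X) = (π(log(W_j(c)* · Ū^j(U·exp X)(c))))_{(j,c)}`, indexed by the
enumerated constrained bonds of levels `≤ k`, with values in `𝔰𝔲(N)` (`π = suProj`, the identity on `𝔰𝔲(N)` where `log` of an `SU(N)` matrix near `1` lands).  This is the chart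
35a (`IsFibreChartNear`) asks for; print's rôle for it is the LINEARIZING TRANSFORMATION of Sect. C. [cite: Balaban1985Variational, Sect. C (47)–(48) p.285, (82)–(83) p.290; Balaban1988Convergent, (2.10)–(2.12) p.256] -/
def msChartB (K k : ℕ) (𝔅 : BDetSet (F.P K)) (W : MSField (F.P K) (SU N)) (U : GaugeField (F.P K) 0 (SU N))
    (X : PBond (F.P K) 0 → lieSU (Fin N)) : Fin (constrCardB 𝔅 k) → lieSU (Fin N) := fun i =>
  suProj N (mlog (relAvg K W (expChart U X) ((constrEnumB 𝔅 k).symm i).1 ((constrEnumB 𝔅 k).symm i).2.1))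

variable {F N}
variable {K k : ℕ} {𝔅 : BDetSet (F.P K)} {W : MSField (F.P K) (SU N)} {U : GaugeField (F.P K) 0 (SU N)}

/-- Unfolding the chart at an index. [cite: Balaban1985Variational, (82)–(83) p.290 (bookkeeping)] -/
theorem msChartB_apply (X : PBond (F.P K) 0 → lieSU (Fin N)) (i : Fin (constrCardB 𝔅 k)) :
    msChartB F N K k 𝔅 W U X i = suProj N (mlog (relAvg K W (expChart U X) ((constrEnumB 𝔅 k).symm i).1 ((constrEnumB 𝔅 k).symm i).2.1)) := rfl

/-- On the fibre the relative averages at constrained bonds are `1`. [cite: Balaban1988Convergent, (2.10) p.256] -/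
theorem relAvg_eq_one_of_agreeOnB {V : GaugeField (F.P K) 0 (SU N)} (hV : AgreeOnB 𝔅 (avgFamily (avOfRecord F N K) V) W) {j : ℕ} {c : PBond (F.P K) j}
    (hc : c ∈ (𝔅 j)) : relAvg K W V j c = 1 := by
  rw [relAvg, hV j c hc, star_coe_mul_coe_SU]

/-- **The chart is centred on the fibre**: `Φ(0) = 0` when `U` lies in the fibre `𝔅(𝐁, W)`. [cite: Balaban1985Variational, (3) p.278; Balaban1988Convergent, (2.10) p.256] -/
theorem msChartB_zero_of_agreeOnB (hU : AgreeOnB 𝔅 (avgFamily (avOfRecord F N K) U) W) : msChartB F N K k 𝔅 W U 0 = 0 := by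
  funext i
  rw [msChartB_apply, expChart_zero, relAvg_eq_one_of_agreeOnB hU ((constrEnumB 𝔅 k).symm i).2.2, mlog_one, map_zero]
  rfl

/-! ## §4  Strict differentiability of the chart at `0` (35b-i: the averaging is `C^∞` on the guard; `log` is analytic near `1`) and the derivative in velocity currency -/

/-- ★ **THE CHART IS `C^∞` AT `0`** when `U` lies in the fibre and the iterated averages of `U·exp X` stay on the small-field guard for `X` near `0` (then each component is
`π ∘ log ∘ (W* · iterM j ↑(U·exp X))(c))` near `0`, with `log` analytic at `W*W = 1`). [cite: Balaban1987RG1, (0.4) p.253; Balaban1985Averaging, (21) p.21; Balaban1985Variational, Sect. C p.285] -/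
theorem contDiffAt_msChartB (hU : AgreeOnB 𝔅 (avgFamily (avOfRecord F N K) U) W)
    (hsb : SmallBelow (avOfRecord F N K) k U) :
    ContDiffAt ℝ ⊤ (msChartB F N K k 𝔅 W U) 0 := by
  have hsb0 := hsb
  have hsbN : ∀ᶠ X in 𝓝 (0 : PBond (F.P K) 0 → lieSU (Fin N)), SmallBelow (avOfRecord F N K) k (expChart U X) :=
    eventually_smallBelow_expChart (P := F.P K) hsb
  refine contDiffAt_pi.2 fun i => ?_
  set s := (constrEnumB 𝔅 k).symm i with hs
  have hj : (s.1 : ℕ) ≤ k := Nat.lt_succ_iff.1 s.1.2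
  -- the smooth model of component `i`
  have hmodel : ContDiffAt ℝ ⊤ (fun X : PBond (F.P K) 0 → lieSU (Fin N) =>
      suProj N (mlog (star ((W s.1 s.2.1 : SU N) : Matrix (Fin N) (Fin N) ℂ) * iterM s.1 (coeField (expChart U X)) s.2.1))) 0 := by
    have hin := contDiffAt_star_mul_iterM_expChart hsb0 hj s.2.1 (star ((W s.1 s.2.1 : SU N) : Matrix (Fin N) (Fin N) ℂ))
    have h0 : star ((W s.1 s.2.1 : SU N) : Matrix (Fin N) (Fin N) ℂ) * iterM s.1 (coeField (expChart U 0)) s.2.1 = 1 := by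
      rw [← relAvg_expChart_eq_of_smallBelow (by rw [expChart_zero]; exact hsb0) hj, expChart_zero]
      exact relAvg_eq_one_of_agreeOnB hU s.2.2
    have hlog : ContDiffAt ℝ ⊤ (mlog : Matrix (Fin N) (Fin N) ℂ → Matrix (Fin N) (Fin N) ℂ)
        (star ((W s.1 s.2.1 : SU N) : Matrix (Fin N) (Fin N) ℂ) * iterM s.1 (coeField (expChart U 0)) s.2.1) := by
      rw [h0]
      exact ((analyticAt_mlog (by simp)).contDiffAt).restrict_scalars ℝ
    have hcomp : ContDiffAt ℝ ⊤ (fun X : PBond (F.P K) 0 → lieSU (Fin N) =>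
        mlog (star ((W s.1 s.2.1 : SU N) : Matrix (Fin N) (Fin N) ℂ) * iterM s.1 (coeField (expChart U X)) s.2.1)) 0 :=
      ContDiffAt.comp (g := (mlog : Matrix (Fin N) (Fin N) ℂ → Matrix (Fin N) (Fin N) ℂ))
        (f := fun X : PBond (F.P K) 0 → lieSU (Fin N) => star ((W s.1 s.2.1 : SU N) : Matrix (Fin N) (Fin N) ℂ) * iterM s.1 (coeField (expChart U X)) s.2.1)
        0 hlog hin
    exact (suProj N).contDiff.contDiffAt.comp 0 hcomp
  refine hmodel.congr_of_eventuallyEq (hsbN.mono fun X hX => ?_)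
  show msChartB F N K k 𝔅 W U X i = _
  rw [msChartB_apply, ← hs, relAvg_expChart_eq_of_smallBelow hX hj]

/-- ★ **HENCE STRICTLY DIFFERENTIABLE AT `0`**, with derivative `Φ′ := fderiv Φ 0` — the first clause of `IsFibreChartNear`. [cite: Balaban1985Variational, (82)–(83) p.290] -/
theorem hasStrictFDerivAt_msChartB (hU : AgreeOnB 𝔅 (avgFamily (avOfRecord F N K) U) W)
    (hsb : SmallBelow (avOfRecord F N K) k U) :
    HasStrictFDerivAt (msChartB F N K k 𝔅 W U) (fderiv ℝ (msChartB F N K k 𝔅 W U) 0) 0 :=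
  (contDiffAt_msChartB hU hsb).hasStrictFDerivAt (by simp)

/-- ★★ **THE DERIVATIVE OF THE CHART IN VELOCITY CURRENCY** (the linearised constraint, read through `log` at `1`): if the matrix of `Ū^j(U·exp(tX))(c)` has velocity `v`
at `t = 0` at the constrained bond `(j, c)` enumerated `i`, then `(Φ′X)_i = π(W_j(c)* · v)` — `D log(1) = id` (`B7TransferAnalyticMean.hasFDerivAt_mlog_one`).
[cite: Balaban1985Variational, Sect. C (44)–(48) p.285 (the linearised averaging), (83) p.290] -/
theorem fderiv_msChartB_apply_of_hasDerivAt (hU : AgreeOnB 𝔅 (avgFamily (avOfRecord F N K) U) W)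
    (hsb : SmallBelow (avOfRecord F N K) k U)
    (X : PBond (F.P K) 0 → lieSU (Fin N)) (i : Fin (constrCardB 𝔅 k)) {v : Matrix (Fin N) (Fin N) ℂ}
    (hv : HasDerivAt (fun t : ℝ => ((avgFamily (avOfRecord F N K) (expChart U (t • X)) ((constrEnumB 𝔅 k).symm i).1 ((constrEnumB 𝔅 k).symm i).2.1 : SU N) :
      Matrix (Fin N) (Fin N) ℂ)) v 0) :
    fderiv ℝ (msChartB F N K k 𝔅 W U) 0 X i = suProj N (star ((W ((constrEnumB 𝔅 k).symm i).1 ((constrEnumB 𝔅 k).symm i).2.1 : SU N) : Matrix (Fin N) (Fin N) ℂ) * v) := by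
  set s := (constrEnumB 𝔅 k).symm i with hs
  set Ws : Matrix (Fin N) (Fin N) ℂ := star ((W s.1 s.2.1 : SU N) : Matrix (Fin N) (Fin N) ℂ) with hWs
  -- the chart along the ray has derivative `Φ′X`
  have hray : HasDerivAt (fun t : ℝ => msChartB F N K k 𝔅 W U (t • X)) (fderiv ℝ (msChartB F N K k 𝔅 W U) 0 X) 0 := by
    have h := (hasStrictFDerivAt_msChartB hU hsb).hasFDerivAt.comp_hasDerivAt_of_eq (0 : ℝ) (hasDerivAt_ray X) (zero_smul ℝ X).symm
    exact h
  have hrayi : HasDerivAt (fun t : ℝ => msChartB F N K k 𝔅 W U (t • X) i) (fderiv ℝ (msChartB F N K k 𝔅 W U) 0 X i) 0 := (hasDerivAt_pi.1 hray) i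
  -- direct computation of the component along the ray
  have hg : HasDerivAt (fun t : ℝ => Ws * ((avgFamily (avOfRecord F N K) (expChart U (t • X)) s.1 s.2.1 : SU N) : Matrix (Fin N) (Fin N) ℂ)) (Ws * v) 0 :=
    hv.const_mul Ws
  have hg0 : Ws * ((avgFamily (avOfRecord F N K) (expChart U ((0 : ℝ) • X)) s.1 s.2.1 : SU N) : Matrix (Fin N) (Fin N) ℂ) = 1 := by
    rw [zero_smul, expChart_zero]
    exact relAvg_eq_one_of_agreeOnB hU s.2.2
  have hlog : HasDerivAt (fun t : ℝ => mlog (Ws * ((avgFamily (avOfRecord F N K) (expChart U (t • X)) s.1 s.2.1 : SU N) : Matrix (Fin N) (Fin N) ℂ))) (Ws * v) 0 := by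
    have hD : HasFDerivAt (mlog : Matrix (Fin N) (Fin N) ℂ → Matrix (Fin N) (Fin N) ℂ)
        (((1 : Matrix (Fin N) (Fin N) ℂ →L[ℂ] Matrix (Fin N) (Fin N) ℂ)).restrictScalars ℝ)
        (Ws * ((avgFamily (avOfRecord F N K) (expChart U ((0 : ℝ) • X)) s.1 s.2.1 : SU N) : Matrix (Fin N) (Fin N) ℂ)) := by
      rw [hg0]
      exact (B7TransferAnalyticMean.hasFDerivAt_mlog_one).restrictScalars ℝ
    have h := hD.comp_hasDerivAt (0 : ℝ) hg
    rw [ContinuousLinearMap.coe_restrictScalars', one_apply_eq_self] at h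
    exact h
  have hdirect : HasDerivAt (fun t : ℝ => msChartB F N K k 𝔅 W U (t • X) i) (suProj N (Ws * v)) 0 := by
    have h := (suProj N).hasFDerivAt.comp_hasDerivAt (0 : ℝ) hlog
    exact h
  exact hrayi.unique hdirect

/-! ## §5  The level set of the chart through `0` lies in the fibre (near `0`) -/

/-- Near `0` every relative average at a constrained bond of level `≤ k` is `ρ_N`-close to `1` (continuity of the smooth model at `0`, where it equals `1`).
[cite: Balaban1987RG1, (0.4) p.253; Balaban1988Convergent, (2.10) p.256] -/
theorem eventually_norm_relAvg_sub_one_le_constrB (hU : AgreeOnB 𝔅 (avgFamily (avOfRecord F N K) U) W)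
    (hsb : SmallBelow (avOfRecord F N K) k U) :
    ∀ᶠ X in 𝓝 (0 : PBond (F.P K) 0 → lieSU (Fin N)), ∀ i : Fin (constrCardB 𝔅 k),
      ‖relAvg K W (expChart U X) ((constrEnumB 𝔅 k).symm i).1 ((constrEnumB 𝔅 k).symm i).2.1 - 1‖ ≤ rhoSU N := by
  have hsb0 := hsb
  have hsbN : ∀ᶠ X in 𝓝 (0 : PBond (F.P K) 0 → lieSU (Fin N)), SmallBelow (avOfRecord F N K) k (expChart U X) :=
    eventually_smallBelow_expChart (P := F.P K) hsb
  refine eventually_all.2 fun i => ?_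
  set s := (constrEnumB 𝔅 k).symm i with hs
  have hj : (s.1 : ℕ) ≤ k := Nat.lt_succ_iff.1 s.1.2
  set gM : (PBond (F.P K) 0 → lieSU (Fin N)) → Matrix (Fin N) (Fin N) ℂ :=
    fun X => star ((W s.1 s.2.1 : SU N) : Matrix (Fin N) (Fin N) ℂ) * iterM s.1 (coeField (expChart U X)) s.2.1 with hgM
  have hcont : ContinuousAt gM 0 := (contDiffAt_star_mul_iterM_expChart hsb0 hj s.2.1 _).continuousAt
  have h0 : gM 0 = 1 := by
    rw [hgM]
    show star ((W s.1 s.2.1 : SU N) : Matrix (Fin N) (Fin N) ℂ) * iterM s.1 (coeField (expChart U 0)) s.2.1 = 1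
    rw [← relAvg_expChart_eq_of_smallBelow (by rw [expChart_zero]; exact hsb0) hj, expChart_zero]
    exact relAvg_eq_one_of_agreeOnB hU s.2.2
  have hnear : ∀ᶠ X in 𝓝 (0 : PBond (F.P K) 0 → lieSU (Fin N)), ‖gM X - 1‖ ≤ rhoSU N := by
    have ht : Tendsto gM (𝓝 0) (𝓝 1) := by rw [← h0]; exact hcont.tendsto
    have hball := (Metric.tendsto_nhds.1 ht) (rhoSU N) rhoSU_pos
    exact hball.mono fun X hX => by rw [dist_eq_norm] at hX; exact hX.le
  exact (hnear.and hsbN).mono fun X hX => by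
    rw [relAvg_expChart_eq_of_smallBelow hX.2 hj]
    exact hX.1

/-- ★ **THE LEVEL SET OF THE CHART THROUGH `0` LIES IN THE FIBRE, NEAR `0`** (the third clause of `IsFibreChartNear`): for `X` near `0`, `Φ(X) = Φ(0)` forces `Ū^j(U·exp X) = W_j` on
every bond meeting `Γ_j`, `j ≤ k` (§2: `π(log g) = 0 ⇒ g = 1` for `g ∈ SU(N)` `ρ_N`-close to `1`), and the members above `k` are empty. [cite: Balaban1985Variational, (3) p.278, (82)–(83) p.290; Balaban1988Convergent, (2.10) p.256] -/
theorem eventually_agreeOnB_of_msChartB_eq (h𝔅 : ∀ j, k < j → 𝔅 j = ∅) (hU : AgreeOnB 𝔅 (avgFamily (avOfRecord F N K) U) W)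
    (hsb : SmallBelow (avOfRecord F N K) k U) :
    ∀ᶠ X in 𝓝 (0 : PBond (F.P K) 0 → lieSU (Fin N)),
      msChartB F N K k 𝔅 W U X = msChartB F N K k 𝔅 W U 0 → AgreeOnB 𝔅 (avgFamily (avOfRecord F N K) (expChart U X)) W := by
  refine (eventually_norm_relAvg_sub_one_le_constrB hU hsb).mono fun X hX hΦ j c hc => ?_
  by_cases hj : j ≤ k
  · set s : ConstrSetB 𝔅 k := ⟨⟨j, Nat.lt_succ_of_le hj⟩, c, hc⟩ with hs
    have hi := congrFun hΦ (constrEnumB 𝔅 k s)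
    rw [msChartB_zero_of_agreeOnB hU] at hi
    rw [msChartB_apply, Equiv.symm_apply_apply] at hi
    have hρ := hX (constrEnumB 𝔅 k s)
    rw [Equiv.symm_apply_apply] at hρ
    exact avg_eq_of_relAvg_eq_one (eq_one_of_suProj_mlog_eq_zero (relAvg_mem_SU _ _ _) hρ hi)
  · exfalso
    have he : 𝔅 j = ∅ := h𝔅 j (lt_of_not_ge hj)
    rw [he] at hc
    simp at hc

/-! ## §6  `IsFibreChartNear` from a right inverse of the linearised constraint ((45) at `U`, velocity currency), and the tangent form on the multi-scale fibre -/

/-- ★★ **35a's `IsFibreChartNear` FOR THE MULTI-SCALE FIBRE `𝔅(𝐁, W)`, FROM [15] (45) AT `U`.**  Hypotheses: `𝐁` has no member above `k`; `U` lies in the fibre; the iterated averages of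
`U·exp X` stay on the small-field guard for `X` near `0`; and (45) AT `U` IN VELOCITY CURRENCY — every family of tangent targets `W_j(c)·τ_j(c)`, `τ_j(c) ∈ 𝔰𝔲(N)`, on the constrained bonds of
levels `≤ k` is the velocity family at `t = 0` of `t ↦ Ū^j(U·exp(tX))(c)` for some direction `X` (i.e. the linearised multi-scale constraint at `U` has a right inverse — print's `H` with
`L^jηQ_jHB = B on Λ_j` (45), here only its EXISTENCE).  Then the canonical chart `Φ` is a submersive chart of the constraint near `U`.
[cite: Balaban1985Variational, (45)–(48) p.285, Prop. 3 p.289, (82)–(83) p.290; Balaban1988Convergent, (2.10)–(2.12) p.256] -/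
theorem isFibreChartNearB_msChartB (h𝔅 : ∀ j, k < j → 𝔅 j = ∅) (hU : AgreeOnB 𝔅 (avgFamily (avOfRecord F N K) U) W)
    (hsb : SmallBelow (avOfRecord F N K) k U)
    (hH : ∀ τ : (j : ℕ) → PBond (F.P K) j → lieSU (Fin N), ∃ X : PBond (F.P K) 0 → lieSU (Fin N), ∀ j, j ≤ k → ∀ c ∈ (𝔅 j),
      HasDerivAt (fun t : ℝ => ((avgFamily (avOfRecord F N K) (expChart U (t • X)) j c : SU N) : Matrix (Fin N) (Fin N) ℂ))
        (((W j c : SU N) : Matrix (Fin N) (Fin N) ℂ) * ((τ j c : lieSU (Fin N)) : Matrix (Fin N) (Fin N) ℂ)) 0) :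
    IsFibreChartNearB F N K 𝔅 W U (msChartB F N K k 𝔅 W U) (fderiv ℝ (msChartB F N K k 𝔅 W U) 0) := by
  classical
  refine ⟨hasStrictFDerivAt_msChartB hU hsb, ?_, eventually_agreeOnB_of_msChartB_eq h𝔅 hU hsb⟩
  -- the derivative is onto: realise any `τ′ : Fin m → 𝔰𝔲(N)` as `Φ′X`
  refine LinearMap.range_eq_top.2 fun τ' => ?_
  let τ : (j : ℕ) → PBond (F.P K) j → lieSU (Fin N) := fun j c =>
    if h : j < k + 1 ∧ c ∈ (𝔅 j) then τ' (constrEnumB 𝔅 k ⟨⟨j, h.1⟩, c, h.2⟩) else 0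
  obtain ⟨X, hX⟩ := hH τ
  refine ⟨X, funext fun i => ?_⟩
  set s := (constrEnumB 𝔅 k).symm i with hs
  have hj : (s.1 : ℕ) ≤ k := Nat.lt_succ_iff.1 s.1.2
  have hv := hX s.1 hj s.2.1 s.2.2
  have hτ : τ s.1 s.2.1 = τ' i := by
    show (if h : (s.1 : ℕ) < k + 1 ∧ (s.2.1 : PBond (F.P K) s.1) ∈ (𝔅 s.1) then τ' (constrEnumB 𝔅 k ⟨⟨s.1, h.1⟩, s.2.1, h.2⟩) else 0) = τ' i
    rw [dif_pos ⟨s.1.2, s.2.2⟩]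
    show τ' (constrEnumB 𝔅 k s) = τ' i
    rw [hs, Equiv.apply_symm_apply]
  show fderiv ℝ (msChartB F N K k 𝔅 W U) 0 X i = τ' i
  rw [fderiv_msChartB_apply_of_hasDerivAt hU hsb X i hv, ← mul_assoc, star_coe_mul_coe_SU, one_mul, hτ, suProj_coe]

/-- ★★★ **CURVE-CRITICAL ⇒ TANGENT-CRITICAL ON A MULTI-SCALE FIBRE, MODULO [15] (45) AT `U`.**  For a determining set `𝐁` with no member above `k`, a configuration `U` in the fibre
`𝔅(𝐁, W)` whose chart neighbours stay on the small-field guard, and a right inverse (velocity currency) of the linearised multi-scale constraint at `U`: if `U` is a critical configuration of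
the Wilson action (5) on the fibre in the CURVE form (`IsCritOnFibre`), then `d∕dt A(U·exp(tX))∣_{t=0} = 0` for EVERY kernel direction `X` of the linearised constraint — print's (82) on the
tangent space (83), for the multi-scale fibre of [III] (2.10)–(2.12) (stub 1's `genSet s.Ω k` included).  Proof: §6's chart + 35a `hasDerivAt_wilsonAction4_expChart_of_isCritOnFibreB_near`.
[cite: Balaban1985Variational, (82)–(83) p.290, (141) p.299, p.300, Prop. 8 p.304, Sect. C (45)–(48) p.285; Balaban1988Convergent, (2.10)–(2.12) p.256] -/
theorem hasDerivAt_wilsonAction4_expChart_of_isCritOnFibreB_of_rightInverse (h𝔅 : ∀ j, k < j → 𝔅 j = ∅)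
    (hU : AgreeOnB 𝔅 (avgFamily (avOfRecord F N K) U) W)
    (hsb : SmallBelow (avOfRecord F N K) k U)
    (hH : ∀ τ : (j : ℕ) → PBond (F.P K) j → lieSU (Fin N), ∃ X : PBond (F.P K) 0 → lieSU (Fin N), ∀ j, j ≤ k → ∀ c ∈ (𝔅 j),
      HasDerivAt (fun t : ℝ => ((avgFamily (avOfRecord F N K) (expChart U (t • X)) j c : SU N) : Matrix (Fin N) (Fin N) ℂ))
        (((W j c : SU N) : Matrix (Fin N) (Fin N) ℂ) * ((τ j c : lieSU (Fin N)) : Matrix (Fin N) (Fin N) ℂ)) 0)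
    (hcrit : IsCritOnFibreB F N K 𝔅 W U) {X : PBond (F.P K) 0 → lieSU (Fin N)}
    (hX : ∀ j, j ≤ k → ∀ c ∈ (𝔅 j),
      HasDerivAt (fun t : ℝ => ((avgFamily (avOfRecord F N K) (expChart U (t • X)) j c : SU N) : Matrix (Fin N) (Fin N) ℂ)) 0 0) :
    HasDerivAt (fun t : ℝ => wilsonAction4 (expChart U (t • X))) 0 0 := by
  refine hasDerivAt_wilsonAction4_expChart_of_isCritOnFibreB_near (isFibreChartNearB_msChartB h𝔅 hU hsb hH) hcrit ?_
  funext i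
  set s := (constrEnumB 𝔅 k).symm i with hs
  have hv := hX s.1 (Nat.lt_succ_iff.1 s.1.2) s.2.1 s.2.2
  have h := fderiv_msChartB_apply_of_hasDerivAt hU hsb X i hv
  rw [mul_zero, map_zero] at h
  exact h

/-- PRINT's reading: the same on the [II] (2.3) fibre `𝔅(lamBondsSeq Ω k, W)` (no member above `k`, F0a `lamBondsSeq_of_gt`). [cite: Balaban1984PropagatorsII, (2.3) p.224; Balaban1988Convergent, (2.10)–(2.12) p.256; Balaban1985Variational, Prop. 8 p.304] -/
theorem hasDerivAt_wilsonAction4_expChart_of_isCritOnFibreB_lamBondsSeq_of_rightInverse {Ω : ℕ → Set (Site (F.P K) 0)}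
    (hU : AgreeOnB (lamBondsSeq Ω k) (avgFamily (avOfRecord F N K) U) W)
    (hsb : SmallBelow (avOfRecord F N K) k U)
    (hH : ∀ τ : (j : ℕ) → PBond (F.P K) j → lieSU (Fin N), ∃ X : PBond (F.P K) 0 → lieSU (Fin N), ∀ j, j ≤ k → ∀ c ∈ (lamBondsSeq Ω k j),
      HasDerivAt (fun t : ℝ => ((avgFamily (avOfRecord F N K) (expChart U (t • X)) j c : SU N) : Matrix (Fin N) (Fin N) ℂ))
        (((W j c : SU N) : Matrix (Fin N) (Fin N) ℂ) * ((τ j c : lieSU (Fin N)) : Matrix (Fin N) (Fin N) ℂ)) 0)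
    (hcrit : IsCritOnFibreB F N K (lamBondsSeq Ω k) W U) {X : PBond (F.P K) 0 → lieSU (Fin N)}
    (hX : ∀ j, j ≤ k → ∀ c ∈ (lamBondsSeq Ω k j),
      HasDerivAt (fun t : ℝ => ((avgFamily (avOfRecord F N K) (expChart U (t • X)) j c : SU N) : Matrix (Fin N) (Fin N) ℂ)) 0 0) :
    HasDerivAt (fun t : ℝ => wilsonAction4 (expChart U (t • X))) 0 0 :=
  hasDerivAt_wilsonAction4_expChart_of_isCritOnFibreB_of_rightInverse (fun _ hj => lamBondsSeq_of_gt Ω k hj) hU hsb hH hcrit hX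

/-! ## §7  The reading-(b) instances: `msChart … 𝐁 = msChartB … (bondsDet 𝐁)` -/

/-- The constrained-bond index type of reading (b) IS the bond-datum one at `bondsDet 𝐁` (definitional). [cite: Balaban1988Convergent, (2.2) p.255 (bookkeeping)] -/
theorem constrSet_eq_constrSetB_bondsDet {P : Params} (𝔹 : DetSet P) (k : ℕ) : ConstrSet 𝔹 k = ConstrSetB (bondsDet 𝔹) k := rfl

/-- `constrCard 𝐁 k = constrCardB (bondsDet 𝐁) k` (definitional). [cite: Balaban1988Convergent, (2.2) p.255 (bookkeeping)] -/
theorem constrCard_eq_constrCardB_bondsDet {P : Params} (𝔹 : DetSet P) (k : ℕ) : constrCard 𝔹 k = constrCardB (bondsDet 𝔹) k := rfl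

/-- **The canonical chart of reading (b) IS the bond-datum chart at `bondsDet 𝐁`** (definitional). [cite: Balaban1985Variational, (82)–(83) p.290; Balaban1988Convergent, (2.10) p.256] -/
theorem msChart_eq_msChartB_bondsDet (𝔹 : DetSet (F.P K)) : msChart F N K k 𝔹 W U = msChartB F N K k (bondsDet 𝔹) W U := rfl

end Chart

end Literature.MathematicalPhysics.QuantumFieldTheory.Balaban1983to89.Node00

end
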